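import Mathlib.Analysis.Calculus.FDeriv.Symmetric
import Literature.Geometry.Lorentzian.Basic
import Literature.Geometry.Lorentzian.CoordCurvature
import HarnessLib

/-!
# Crux `GapExhaustion` (stmt-FinalStateConjecture-10808), line `photon-shell-pseudoconvexity`:
# stub (K-A2) `stub_killingHessianAlt` — the Ricci identity for a `C²` vector field

Route `BartnikGapSettling`; helper (`--supports stmt-FinalStateConjecture-10808`) landing the
registered sub-stub (K-A2) of the local unique-continuation tool for Killing fields (line lead c8,
wave 2). Coordinate pseudo-Riemannian calculus on `E4` with the components `G` of a metric on an
open set `V` (`IsMetricOn G V`), their Christoffel map `chrAt G x = Γ_x` and curvature endomorphism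
`riemAt G x X Y = R_x(X, Y)` (`Literature.Geometry.Lorentzian.CoordCurvature`).

For a `C²` map `K : E4 → E4` write `A_y Y := DK(y) Y + Γ_y(Y, K y)` (`= ∇_Y K` on the constant field
`Y`) and `B(X, Y, Z) := G_x(∂_X (A · Y)(x) + Γ_x(X, A_x Y) − A_x(Γ_x(X, Y)), Z)`
(`= G((∇_X ∇K) Y, Z)`). The statement is the **Ricci identity**
`B(X, Y, Z) − B(Y, X, Z) = G_x(R_x(X, Y) K x, Z)`; no Killing equation is involved.

Proof: `∂_X (A · Y)(x) = D²K(x)(X, Y) + DΓ(x)(X)(Y, K x) + Γ_x(Y, DK(x) X)` (Leibniz rule for the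
evaluation of the operator-valued `y ↦ Γ_y(Y, ·)` at `K y`); the second derivative of the `C²` map
`K` is symmetric and `Γ` is torsion-free (`Γ(X,Y) = Γ(Y,X)`), so in the antisymmetrisation the
`D²K` terms, the `A(Γ(X,Y))` terms and the mixed `Γ(·, DK ·)` terms cancel, leaving
`DΓ(X)(Y, K) − DΓ(Y)(X, K) + Γ(X, Γ(Y, K)) − Γ(Y, Γ(X, K)) = R(X, Y) K` (`riemAt_apply`).
-/

noncomputable section

-- instance search through the nested operator types `E4 →L[ℝ] E4 →L[ℝ] E4 →L[ℝ] ℝ`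
set_option maxSynthPendingDepth 3

-- D-0017: single-problem summit, `Summit.<S>.<S>.…` by design (cf. lakefile `weak.linter.dupNamespace`).
set_option linter.dupNamespace false

namespace Summit.FinalStateConjecture.FinalStateConjecture.Theorems

open Set Filter
open Literature.Geometry.Lorentzian Literature.Geometry.Lorentzian.MetricCoord
open scoped Topology

/-- A `C²` map on the open set `V` of a metric datum has a differentiable derivative at the points
of `V`. [folklore] -/
private theorem killingHessianAlt_differentiableAt_fderiv
    {G : E4 → E4 →L[ℝ] E4 →L[ℝ] ℝ} {V : Set E4} {K : E4 → E4} (hG : IsMetricOn G V)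
    (hK : ContDiffOn ℝ 2 K V) {x : E4} (hx : x ∈ V) :
    DifferentiableAt ℝ (fderiv ℝ K) x :=
  (((hK x hx).contDiffAt (hG.mem_nhds hx)).fderiv_right (m := 1) (by norm_num)).differentiableAt
    one_ne_zero

/-- A `C²` map on the open set `V` of a metric datum is differentiable at the points of `V`.
[folklore] -/
private theorem killingHessianAlt_differentiableAt
    {G : E4 → E4 →L[ℝ] E4 →L[ℝ] ℝ} {V : Set E4} {K : E4 → E4} (hG : IsMetricOn G V)
    (hK : ContDiffOn ℝ 2 K V) {x : E4} (hx : x ∈ V) :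
    DifferentiableAt ℝ K x :=
  ((hK x hx).contDiffAt (hG.mem_nhds hx)).differentiableAt two_ne_zero

/-- **Leibniz rule for `∇K` on a constant field**: the derivative at `x ∈ V` in the direction `X`
of `y ↦ A_y Y = DK(y) Y + Γ_y(Y, K y)` is
`D²K(x)(X)(Y) + DΓ(x)(X)(Y)(K x) + Γ_x(Y, DK(x) X)`. [folklore] -/
private theorem killingHessianAlt_fderiv
    {G : E4 → E4 →L[ℝ] E4 →L[ℝ] ℝ} {V : Set E4} {K : E4 → E4} (hG : IsMetricOn G V)
    (hK : ContDiffOn ℝ 2 K V) {x : E4} (hx : x ∈ V) (X Y : E4) :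
    fderiv ℝ (fun y => fderiv ℝ K y Y + chrAt G y Y (K y)) x X =
      fderiv ℝ (fderiv ℝ K) x X Y + fderiv ℝ (chrAt G) x X Y (K x)
        + chrAt G x Y (fderiv ℝ K x X) := by
  have h1 : HasFDerivAt (fun y => fderiv ℝ K y Y) ((fderiv ℝ (fderiv ℝ K) x).flip Y) x :=
    hasFDerivAt_clm_apply_const (killingHessianAlt_differentiableAt_fderiv hG hK hx).hasFDerivAt Y
  have hc : HasFDerivAt (fun y => chrAt G y Y) ((fderiv ℝ (chrAt G) x).flip Y) x :=
    hasFDerivAt_clm_apply_const (hG.differentiableAt_chrAt hx).hasFDerivAt Y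
  have h2 : HasFDerivAt (fun y => chrAt G y Y (K y))
      ((chrAt G x Y).comp (fderiv ℝ K x) + ((fderiv ℝ (chrAt G) x).flip Y).flip (K x)) x :=
    hc.clm_apply (killingHessianAlt_differentiableAt hG hK hx).hasFDerivAt
  have h : HasFDerivAt (fun y => fderiv ℝ K y Y + chrAt G y Y (K y))
      ((fderiv ℝ (fderiv ℝ K) x).flip Y
        + ((chrAt G x Y).comp (fderiv ℝ K x) + ((fderiv ℝ (chrAt G) x).flip Y).flip (K x))) x :=
    h1.add h2
  rw [h.fderiv]
  simp only [add_apply, ContinuousLinearMap.flip_apply, ContinuousLinearMap.comp_apply]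
  abel

/-- **Symmetry of the second derivative** of a `C²` map at the points of the open set `V`:
`D²K(x)(X)(Y) = D²K(x)(Y)(X)`. [folklore] -/
private theorem killingHessianAlt_fderiv_fderiv_comm
    {G : E4 → E4 →L[ℝ] E4 →L[ℝ] ℝ} {V : Set E4} {K : E4 → E4} (hG : IsMetricOn G V)
    (hK : ContDiffOn ℝ 2 K V) {x : E4} (hx : x ∈ V) (X Y : E4) :
    fderiv ℝ (fderiv ℝ K) x X Y = fderiv ℝ (fderiv ℝ K) x Y X :=
  ((hK x hx).contDiffAt (hG.mem_nhds hx)).isSymmSndFDerivAt (by simp) X Y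

/-- **(K-A2) The Ricci identity for a `C²` vector field, in coordinates.**
Let `G` be the components of a pseudo-Riemannian metric on the open set `V ⊆ E4` (`IsMetricOn`),
`Γ = chrAt G`, `R = riemAt G`, and let `K : E4 → E4` be `C²` on `V`. With
`A_y Y := DK(y) Y + Γ_y(Y, K y)` (`= ∇_Y K`) and
`B(X,Y,Z) := G_x(∂_X(A · Y)(x) + Γ_x(X, A_x Y) − A_x(Γ_x(X,Y)), Z)` (`= G((∇_X∇K)Y, Z)`), for all
`x ∈ V` and `X Y Z : E4`: `B(X,Y,Z) − B(Y,X,Z) = G_x(R_x(X,Y) K x, Z)`, i.e.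
`∇²_{X,Y} K − ∇²_{Y,X} K = R(X,Y) K` (O'Neill 1983, Ch. 3, Lemma 3.38 ff.; Kobayashi–Nomizu I,
Ch. III, Prop. 7.6 / Ch. VI, §2). Symmetry of `D²K`, torsion-freeness of `Γ` and `riemAt_apply`.
[folklore] -/
theorem stub_killingHessianAlt :
    ∀ (G : E4 → E4 →L[ℝ] E4 →L[ℝ] ℝ) (V : Set E4) (K : E4 → E4),
      IsMetricOn G V → ContDiffOn ℝ 2 K V →
      ∀ x ∈ V, ∀ X Y Z : E4,
        G x (fderiv ℝ (fun y => fderiv ℝ K y Y + chrAt G y Y (K y)) x X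
            + chrAt G x X (fderiv ℝ K x Y + chrAt G x Y (K x))
            - (fderiv ℝ K x (chrAt G x X Y) + chrAt G x (chrAt G x X Y) (K x))) Z
        - G x (fderiv ℝ (fun y => fderiv ℝ K y X + chrAt G y X (K y)) x Y
            + chrAt G x Y (fderiv ℝ K x X + chrAt G x X (K x))
            - (fderiv ℝ K x (chrAt G x Y X) + chrAt G x (chrAt G x Y X) (K x))) Z
        = G x (riemAt G x X Y (K x)) Z := by
  intro G V K hG hK x hx X Y Z
  rw [killingHessianAlt_fderiv hG hK hx X Y, killingHessianAlt_fderiv hG hK hx Y X,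
    killingHessianAlt_fderiv_fderiv_comm hG hK hx Y X, hG.chrAt_comm hx Y X, riemAt_apply]
  simp only [map_add, map_sub, add_apply, sub_apply]
  abel

end Summit.FinalStateConjecture.FinalStateConjecture.Theorems

end
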